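import Literature.Barriers.KontsevichZagierPeriods.AlgebraicPrimitivesObstruction
import Literature.NumberTheory.Transcendental.SemialgebraicMonotonicityDefinable
import Literature.NumberTheory.Transcendental.KZSemiCanonicalReductionDimOne

/-!
# Route ScissorsTransport — `DimOneTransportFails`: kit (one-variable transcendence descent)

Problem `KontsevichZagierPeriods`, route `ScissorsTransport`, support item
stmt-KontsevichZagierPeriods-2671 (`DimOneTransportFails`). This helper file collects the
def-free tools used by the closing file `ScissorsTransportDimOneTransportFails.lean`:

* §1 the line `ℝ¹`: a `ℚ`-semialgebraic subset of positive measure contains an open interval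
  (`exists_Ioo_subset_of_volume_ne_zero`, from van den Dries' description of definable subsets of
  the line, `SemialgebraicMonotonicity.exists_Ioo_subset_of_infinite`);
* §2 a `ℚ`-semialgebraic function `F` of one variable on ANY set `A ⊆ ℝ¹` satisfies a non-trivial
  real polynomial relation, recorded with the variables SWAPPED: `P(F x, x 0) = 0` on `A`, `P ≠ 0`
  in `ℝ[X][Y]` (steps (A)–(B) of the barrier file `AlgebraicPrimitivesObstruction`);
* §3 the simple-pole descent of the barrier file with the roles of the variable and the function
  exchanged (`eq_zero_of_evalEval_swap_eq_zero`): if `φ` is differentiable and injective on an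
  open interval with `N(φ) φ' = (φ − x₀) V(φ)`, `V(x₀) N(x₀) ≠ 0` — i.e. the INVERSE of `φ` has the
  rational derivative `N / ((X − x₀) V)` with a non-zero residue at `x₀` — then no non-zero
  `P ∈ ℝ[X][Y]` has `P(φ t, t) = 0` along the interval. This is the transcendence of
  `t ↦ G⁻¹(t)` for a primitive `G` of a rational function with a simple pole (here: of
  `y + log y + log (3 − y)`), proved by descent on `deg_Y P` exactly as in the barrier file;
* §4 elementary inputs for the witness pair (rule (1b) in pointwise form, continuity on `[1, 2]`
  and positivity on `(1, 2)` of the rational integrands `1 + 1/y − 1/(3−y)`, `1/y − 1/(3−y)`,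
  `1/y`, `1/(3−y)`).

Sources: Kontsevich–Zagier 2001 §1.2 (the moves); Bochnak–Coste–Roy 1998 §2.1–2.2 and
Basu–Pollack–Roy 2006 Prop. 2.86 (one-variable semialgebraic functions are algebraic); van den
Dries 1998 Ch. 1 (3.2) (definable subsets of the line). Reused from the tree, not restated: the
free-group pinning lemma `PlanarK0InjectiveNegative.eq_of_of_sub_of_eq`, the `1 × 1` determinant
`PlanarCompilerProof.ElementaryMoves.det_eq_apply` (route SymplecticScissors) and
`KZ.eq_const_apply_zero`. Deliberately NOT here: the witness pair and the route declaration
(closing file).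
-/

noncomputable section

open Set MeasureTheory Filter Topology
open Literature.NumberTheory.Transcendental Literature.ModelTheory.ExponentialFields
open Literature.Barriers.KontsevichZagierPeriods.KZ

namespace Summit.KontsevichZagierPeriods.ScissorsTransport.DimOneTransportFailsKit

/-! ## §1 The line: intervals inside non-null semialgebraic sets -/

/-- **An infinite `ℚ`-semialgebraic subset of the line contains an open interval** (van den Dries
1998, Ch. 1 (3.2), through `SemialgebraicMonotonicity.exists_Ioo_subset_of_infinite`).
[folklore] -/
theorem exists_Ioo_subset_of_not_finite {S : Set (Fin 1 → ℝ)} (hS : IsSemialgebraic ℚ S)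
    (hinf : ¬ S.Finite) : ∃ p q : ℝ, p < q ∧ ∀ t ∈ Ioo p q, (fun _ : Fin 1 => t) ∈ S := by
  set A : Set ℝ := {t | (fun _ : Fin 1 => t) ∈ S} with hA
  have hSA : {z : Fin 1 → ℝ | z 0 ∈ A} = S := by
    ext z
    simp only [mem_setOf_eq, hA]
    rw [← KZ.eq_const_apply_zero z]
  have hAs : IsSemialgebraic ℝ {z : Fin 1 → ℝ | z 0 ∈ A} := by
    rw [hSA]
    exact SemialgebraicMonotonicity.isSemialgebraic_real_of hS
  have hAinf : A.Infinite := by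
    intro hfin
    apply hinf
    have hSeq : S = (fun t : ℝ => (fun _ : Fin 1 => t)) '' A := by
      ext z
      constructor
      · intro hz
        refine ⟨z 0, ?_, (KZ.eq_const_apply_zero z).symm⟩
        show (fun _ : Fin 1 => z 0) ∈ S
        rwa [← KZ.eq_const_apply_zero z]
      · rintro ⟨t, ht, rfl⟩
        exact ht
    rw [hSeq]
    exact hfin.image _
  obtain ⟨p, q, hpq, hsub⟩ := SemialgebraicMonotonicity.exists_Ioo_subset_of_infinite hAs hAinf
  exact ⟨p, q, hpq, fun t ht => hsub ht⟩

/-- **A `ℚ`-semialgebraic subset of the line of non-zero Lebesgue measure contains an open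
interval** (finite sets are null). [folklore] -/
theorem exists_Ioo_subset_of_volume_ne_zero {S : Set (Fin 1 → ℝ)} (hS : IsSemialgebraic ℚ S)
    (hvol : volume S ≠ 0) : ∃ p q : ℝ, p < q ∧ ∀ t ∈ Ioo p q, (fun _ : Fin 1 => t) ∈ S :=
  exists_Ioo_subset_of_not_finite hS fun hfin => hvol (hfin.measure_zero volume)

/-! ## §2 One-variable semialgebraic functions satisfy a polynomial relation (swapped form) -/

open Polynomial in
open scoped Polynomial.Bivariate in
/-- **A `ℚ`-semialgebraic function of one real variable is algebraic**, swapped form: if `F` is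
`ℚ`-semialgebraic on `A ⊆ ℝ¹`, there is a non-zero `P ∈ ℝ[X][Y]` with `P(F x, x 0) = 0` for all
`x ∈ A` (off the zero set of a non-zero real polynomial the graph is open, and a graph has empty
interior — steps (A)–(B) of `AlgebraicPrimitivesObstruction`; then exchange the two variables by
`MvPolynomial.rename (Equiv.swap 0 1)`). [cite: BasuPollackRoy2006, Prop. 2.86] -/
theorem exists_ne_zero_evalEval_swap_eq_zero {A : Set (Fin 1 → ℝ)} {F : (Fin 1 → ℝ) → ℝ}
    (hF : IsSemialgebraicFunOn ℚ A F) :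
    ∃ P : ℝ[X][Y], P ≠ 0 ∧ ∀ x ∈ A, P.evalEval (F x) (x 0) = 0 := by
  set Γ : Set (Fin 2 → ℝ) := {z | ∃ x ∈ A, z = Fin.snoc x (F x)} with hΓ
  have hΓ' : IsSemialgebraic ℚ Γ := hF
  -- (A) a non-zero real polynomial off whose zero set `Γ` is open
  obtain ⟨q, hq0, hopen, -⟩ := NoSemialgPrim.exists_ne_zero_isOpen hΓ'
  -- (B) a graph has empty interior, so `Γ ⊆ {q = 0}`
  have hvan : ∀ z ∈ Γ, MvPolynomial.eval z q = 0 := by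
    intro z hz
    by_contra hne
    obtain ⟨ε, hε, hball⟩ := Metric.isOpen_iff.mp hopen z ⟨hz, hne⟩
    obtain ⟨x, hx, rfl⟩ := hz
    have hmem : (Fin.snoc x (F x + ε / 2) : Fin 2 → ℝ) ∈
        Metric.ball (Fin.snoc x (F x) : Fin 2 → ℝ) ε := by
      rw [Metric.mem_ball, dist_pi_lt_iff hε]
      intro i
      fin_cases i
      · simp [Fin.snoc, hε]
      · simp [Fin.snoc, abs_of_pos hε, half_lt_self hε]
    obtain ⟨⟨x', -, hxx'⟩, -⟩ := hball hmem
    have h0 : x = x' := by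
      funext j
      fin_cases j
      simpa [Fin.snoc] using congrFun hxx' 0
    have h1 := congrFun hxx' 1
    simp only [Fin.snoc] at h1
    simp [← h0] at h1
    exact absurd h1 hε.ne'
  -- swap the two variables
  set q' : MvPolynomial (Fin 2) ℝ := MvPolynomial.rename (Equiv.swap (0 : Fin 2) 1) q with hq'
  have hq'0 : q' ≠ 0 := by
    intro h
    apply hq0
    apply MvPolynomial.rename_injective _ (Equiv.injective (Equiv.swap (0 : Fin 2) 1))
    rw [map_zero]
    exact h
  refine ⟨(Polynomial.Bivariate.equivMvPolynomial ℝ).symm q', by simpa using hq'0, ?_⟩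
  intro x hx
  have hz : (Fin.snoc x (F x) : Fin 2 → ℝ) ∈ Γ := ⟨x, hx, rfl⟩
  have h := hvan _ hz
  set z : Fin 2 → ℝ := Fin.snoc (fun _ : Fin 1 => F x) (x 0) with hzdef
  have hswap : z ∘ (Equiv.swap (0 : Fin 2) 1) = Fin.snoc x (F x) := by
    funext i
    fin_cases i
    · simp [hzdef, Fin.snoc, Equiv.swap_apply_left]
    · simp [hzdef, Fin.snoc, Equiv.swap_apply_right]
  have h2 : MvPolynomial.eval z q' = 0 := by
    rw [hq', MvPolynomial.eval_rename, hswap]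
    exact h
  rw [← NoSemialgPrim.evalEval_equivMvPolynomial_symm] at h2
  simpa [hzdef, Fin.snoc] using h2

/-! ## §3 The simple-pole descent with the variables exchanged -/

open Polynomial in
open scoped Polynomial.Bivariate in
/-- **Analytic input of the swapped descent.** If `φ' ` is the derivative of `φ` on `(p, q)` with
`N(φ t) φ'(t) = D(φ t)` and `∑ⱼ cⱼ(φ s) sʲ = 0` on `(p, q)`, then differentiating and multiplying
by `N(φ t)` gives `∑ⱼ (D(φ t) cⱼ'(φ t) tʲ + j N(φ t) cⱼ(φ t) tʲ⁻¹) = 0`. [folklore] -/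
theorem sum_deriv_eq_zero {φ φ' : ℝ → ℝ} {D N : ℝ[X]} {p q : ℝ}
    (hφ : ∀ t ∈ Ioo p q, HasDerivAt φ (φ' t) t)
    (hDN : ∀ t ∈ Ioo p q, N.eval (φ t) * φ' t = D.eval (φ t))
    (M : ℕ) (c : ℕ → ℝ[X])
    (hv : ∀ s ∈ Ioo p q, ∑ j ∈ Finset.range M, (c j).eval (φ s) * s ^ j = 0)
    {t : ℝ} (ht : t ∈ Ioo p q) :
    ∑ j ∈ Finset.range M,
      (D.eval (φ t) * (derivative (c j)).eval (φ t) * t ^ j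
        + (j : ℝ) * N.eval (φ t) * (c j).eval (φ t) * t ^ (j - 1)) = 0 := by
  have hcomp : ∀ j, HasDerivAt (fun s => (c j).eval (φ s))
      ((derivative (c j)).eval (φ t) * φ' t) t :=
    fun j => ((c j).hasDerivAt (φ t)).comp t (hφ t ht)
  have hf : HasDerivAt (fun s => ∑ j ∈ Finset.range M, (c j).eval (φ s) * s ^ j)
      (∑ j ∈ Finset.range M, ((derivative (c j)).eval (φ t) * φ' t * t ^ j +
        (c j).eval (φ t) * ((j : ℝ) * t ^ (j - 1)))) t :=
    HasDerivAt.fun_sum fun j _ => (hcomp j).mul (hasDerivAt_pow j t)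
  have h0 : HasDerivAt (fun s => ∑ j ∈ Finset.range M, (c j).eval (φ s) * s ^ j) 0 t := by
    apply (hasDerivAt_const t (0:ℝ)).congr_of_eventuallyEq
    filter_upwards [Ioo_mem_nhds ht.1 ht.2] with s hs
    exact hv s hs
  have hsum := hf.unique h0
  calc ∑ j ∈ Finset.range M,
        (D.eval (φ t) * (derivative (c j)).eval (φ t) * t ^ j
          + (j : ℝ) * N.eval (φ t) * (c j).eval (φ t) * t ^ (j - 1))
      = N.eval (φ t) * ∑ j ∈ Finset.range M, ((derivative (c j)).eval (φ t) * φ' t * t ^ j +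
          (c j).eval (φ t) * ((j : ℝ) * t ^ (j - 1))) := by
        rw [Finset.mul_sum]
        refine Finset.sum_congr rfl fun j _ => ?_
        rw [← hDN t ht]
        ring
    _ = 0 := by rw [hsum, mul_zero]

open Polynomial in
open scoped Polynomial.Bivariate in
/-- **Swapped simple-pole descent.** Let `φ` be differentiable and injective on `(p, q)` (`p < q`)
with `N(φ t) φ'(t) = (φ t − x₀) V(φ t)` there, where `V(x₀) N(x₀) ≠ 0` (the inverse function of
`φ` has derivative `N/((X − x₀)V)`, a rational function with a simple pole of non-zero residue at
`x₀`). Then no non-zero `P ∈ ℝ[X][Y]` satisfies `P(φ t, t) = 0` on `(p, q)`: by descent on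
`deg_Y P`, a minimal relation forces the coefficient identity excluded by
`NoSemialgPrimKernel.coeff_identity_ne_zero` (the polynomial shadow of "no function algebraic over
`ℝ(y)` has a derivative with a non-zero residue"); the base case uses that `φ '' (p, q)` is
infinite. The barrier file's `NoSemialgPrimKernel.eq_zero_of_evalEval_eq_zero` is the same
argument with the roles of `t` and `φ t` exchanged. [folklore] -/
theorem eq_zero_of_evalEval_swap_eq_zero {φ φ' : ℝ → ℝ} {V N : ℝ[X]} {x₀ p q : ℝ} (hpq : p < q)
    (hφ : ∀ t ∈ Ioo p q, HasDerivAt φ (φ' t) t)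
    (hDN : ∀ t ∈ Ioo p q, N.eval (φ t) * φ' t = ((X - C x₀) * V).eval (φ t))
    (hV : V.eval x₀ ≠ 0) (hN : N.eval x₀ ≠ 0) (hinj : InjOn φ (Ioo p q)) :
    ∀ (n : ℕ) (P : ℝ[X][Y]), P.natDegree ≤ n →
      (∀ t ∈ Ioo p q, P.evalEval (φ t) t = 0) → P = 0 := by
  intro n
  induction n with
  | zero =>
    intro P hP hv
    have hPC : P = C (P.coeff 0) := eq_C_of_natDegree_le_zero hP
    have h0 : P.coeff 0 = 0 := by
      apply Polynomial.eq_zero_of_infinite_isRoot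
      refine Set.Infinite.mono ?_ ((Set.Ioo_infinite hpq).image hinj)
      rintro _ ⟨t, ht, rfl⟩
      have := hv t ht
      rw [hPC, evalEval_C] at this
      exact this
    rw [hPC, h0, map_zero]
  | succ n ih =>
    intro P hP hv
    by_cases hd : P.natDegree ≤ n
    · exact ih P hd hv
    have hdeg : P.natDegree = n + 1 := by omega
    by_contra hP0
    have hlead : P.coeff (n + 1) ≠ 0 := by
      rw [← hdeg]
      exact leadingCoeff_ne_zero.mpr hP0
    set D : ℝ[X] := (X - C x₀) * V with hD_def
    set c : ℕ → ℝ[X] := fun j => P.coeff j with hc_def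
    set Q₁ : ℝ[X][Y] := ∑ j ∈ Finset.range (n + 2), C (D * derivative (c j)) * Y ^ j with hQ₁
    set Q₂ : ℝ[X][Y] :=
      ∑ j ∈ Finset.range (n + 1), C (C ((j : ℝ) + 1) * N * c (j + 1)) * Y ^ j with hQ₂
    set R : ℝ[X][Y] := C (c (n + 1)) * (Q₁ + Q₂) - C (D * derivative (c (n + 1))) * P with hR
    have hPsum : P = ∑ j ∈ Finset.range (n + 2), C (c j) * Y ^ j := by
      have := P.as_sum_range_C_mul_X_pow
      rw [hdeg] at this
      exact this
    have hfP : ∀ s, P.evalEval (φ s) s = ∑ j ∈ Finset.range (n + 2), (c j).eval (φ s) * s ^ j := by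
      intro s
      conv_lhs => rw [hPsum]
      simp [evalEval_finsetSum, evalEval_C]
    have hv' : ∀ s ∈ Ioo p q, ∑ j ∈ Finset.range (n + 2), (c j).eval (φ s) * s ^ j = 0 :=
      fun s hs => (hfP s) ▸ hv s hs
    -- the derivative polynomial vanishes along the curve
    have hQ : ∀ t ∈ Ioo p q, (Q₁ + Q₂).evalEval (φ t) t = 0 := by
      intro t ht
      have key := sum_deriv_eq_zero hφ hDN (n + 2) c hv' ht
      rw [Finset.sum_add_distrib,
        Finset.sum_range_succ' (fun j => (j : ℝ) * N.eval (φ t) * (c j).eval (φ t) * t ^ (j - 1))]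
        at key
      simp only [Nat.cast_zero, zero_mul, add_zero, Nat.add_sub_cancel, Nat.cast_succ] at key
      have e1 : Q₁.evalEval (φ t) t =
          ∑ j ∈ Finset.range (n + 2), D.eval (φ t) * (derivative (c j)).eval (φ t) * t ^ j := by
        simp only [hQ₁, evalEval_finsetSum, evalEval_mul, evalEval_C, evalEval_pow, evalEval_X,
          eval_mul]
      have e2 : Q₂.evalEval (φ t) t = ∑ j ∈ Finset.range (n + 1),
          ((j : ℝ) + 1) * N.eval (φ t) * (c (j + 1)).eval (φ t) * t ^ j := by
        simp only [hQ₂, evalEval_finsetSum, evalEval_mul, evalEval_C, evalEval_pow, evalEval_X,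
          eval_mul, eval_C]
      rw [evalEval_add, e1, e2]
      exact key
    have hvR : ∀ t ∈ Ioo p q, R.evalEval (φ t) t = 0 := by
      intro t ht
      simp only [hR, evalEval_sub, evalEval_mul, evalEval_C, hQ t ht, hv t ht, mul_zero, sub_zero]
    -- `R` has smaller degree, hence vanishes
    have hcQ₁ : ∀ k, Q₁.coeff k = if k < n + 2 then D * derivative (c k) else 0 := fun k => by
      rw [hQ₁]
      exact NoSemialgPrim.coeff_sum_C_mul_X_pow (fun j => D * derivative (c j)) (n + 2) k
    have hcQ₂ : ∀ k, Q₂.coeff k = if k < n + 1 then C ((k : ℝ) + 1) * N * c (k + 1) else 0 :=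
      fun k => by
      rw [hQ₂]
      exact NoSemialgPrim.coeff_sum_C_mul_X_pow (fun j => C ((j : ℝ) + 1) * N * c (j + 1)) (n + 1) k
    have hcR : ∀ k, R.coeff k = c (n + 1) * (Q₁.coeff k + Q₂.coeff k) -
        D * derivative (c (n + 1)) * P.coeff k := fun k => by
      simp only [hR, coeff_sub, coeff_C_mul, coeff_add]
    have hRdeg : R.natDegree ≤ n := by
      rw [Polynomial.natDegree_le_iff_coeff_eq_zero]
      intro M hM
      rw [hcR, hcQ₁, hcQ₂]
      rcases Nat.lt_or_ge M (n + 2) with h | h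
      · have hM1 : M = n + 1 := by omega
        subst hM1
        simp only [show n + 1 < n + 2 by omega, if_true, lt_irrefl, if_false, add_zero]
        simp only [hc_def]
        ring
      · have hPM : P.coeff M = 0 := coeff_eq_zero_of_natDegree_lt (by omega)
        simp only [show ¬ (M < n + 2) by omega, show ¬ (M < n + 1) by omega, if_false, add_zero,
          mul_zero, hPM, sub_zero]
    have hR0 : R = 0 := ih R hRdeg hvR
    -- the coefficient of `Y ^ n` of `R` is the forbidden identity
    have hcoef := hcR n
    rw [hR0, coeff_zero, hcQ₁, hcQ₂] at hcoef
    simp only [show n < n + 2 by omega, show n < n + 1 by omega, if_true] at hcoef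
    apply NoSemialgPrimKernel.coeff_identity_ne_zero (c (n + 1)) (c n) V N x₀ (n + 1)
      (Nat.succ_ne_zero n) hlead hV hN
    rw [hD_def] at hcoef
    have : (((n + 1 : ℕ) : ℝ)) = (n : ℝ) + 1 := by push_cast; ring
    rw [this]
    linear_combination -hcoef

/-! ## §4 Elementary inputs for the witness pair of the closing file -/

/-- Rule (1b) among representations with a common domain, in the pointwise form used here.
[Kontsevich–Zagier 2001, §1.2, rule (1)] [folklore] -/
theorem sub_sub_mem_integrandAddRel {n : ℕ} {r r₁ r₂ : KZ.IntegralRep n}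
    (h₁ : r₁.domain = r.domain) (h₂ : r₂.domain = r.domain)
    (h : ∀ x ∈ r.domain, r.integrand x = r₁.integrand x + r₂.integrand x) :
    KZ.of r - KZ.of r₁ - KZ.of r₂ ∈ KZ.integrandAddRel :=
  ⟨n, r, r₁, r₂, h₁, h₂, fun x hx => h x hx, rfl⟩

/-- `y ↦ 1 + 1/y − 1/(3 − y)` is continuous on `[1, 2]`. [folklore] -/
theorem continuousOn_g : ContinuousOn (fun y : ℝ => 1 + 1 / y - 1 / (3 - y)) (Icc 1 2) := by
  refine continuousOn_of_forall_continuousAt fun y hy => ?_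
  have hy0 : y ≠ 0 := by linarith [hy.1]
  have hy3 : 3 - y ≠ 0 := by linarith [hy.2]
  fun_prop (disch := assumption)

/-- `y ↦ 1/y − 1/(3 − y)` is continuous on `[1, 2]`. [folklore] -/
theorem continuousOn_d : ContinuousOn (fun y : ℝ => 1 / y - 1 / (3 - y)) (Icc 1 2) := by
  refine continuousOn_of_forall_continuousAt fun y hy => ?_
  have hy0 : y ≠ 0 := by linarith [hy.1]
  have hy3 : 3 - y ≠ 0 := by linarith [hy.2]
  fun_prop (disch := assumption)

/-- `y ↦ 1/y` is continuous on `[1, 2]`. [folklore] -/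
theorem continuousOn_h : ContinuousOn (fun y : ℝ => 1 / y) (Icc 1 2) := by
  refine continuousOn_of_forall_continuousAt fun y hy => ?_
  have hy0 : y ≠ 0 := by linarith [hy.1]
  fun_prop (disch := assumption)

/-- `y ↦ 1/(3 − y)` is continuous on `[1, 2]`. [folklore] -/
theorem continuousOn_k : ContinuousOn (fun y : ℝ => 1 / (3 - y)) (Icc 1 2) := by
  refine continuousOn_of_forall_continuousAt fun y hy => ?_
  have hy3 : 3 - y ≠ 0 := by linarith [hy.2]
  fun_prop (disch := assumption)

/-- The witness integrand `1 + 1/y − 1/(3 − y)` is positive on `(1, 2)` (indeed `> 1/2`).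
[folklore] -/
theorem g_pos {y : ℝ} (h1 : 1 < y) (h2 : y < 2) : 0 < 1 + 1 / y - 1 / (3 - y) := by
  have ha : 0 < 1 / y := by positivity
  have hb : 1 / (3 - y) < 1 := by
    rw [div_lt_one (by linarith)]
    linarith
  linarith

end Summit.KontsevichZagierPeriods.ScissorsTransport.DimOneTransportFailsKit
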